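import Literature.MathematicalPhysics.QuantumFieldTheory.Balaban1983to89.B16Improved189FullBudgetIndex

/-!
# `Balaban1983to89.B16Improved189FullBudgetMergeWitness` — A6 ∕ A2 for the merger (1.85)–(1.88) of [Balaban1989LargeFieldII]
pp. 386–387 in the index model: `B16Lem384Induction.MergeIndex` INHABITED (its first inhabitant in the tree) and
`B16Improved189FullBudgetIndex.mergeT_controls_ofIndex` FIRED at it with a NON-ZERO terminal term

T. Bałaban, *Large field renormalization. II*, Commun. Math. Phys. **122** (1989) 355–392 [Balaban1989LargeFieldII], (1.84)–(1.88)
pp. 386–387; [III] = [Balaban1988Convergent] (2.7) p. 255.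

statement-level bookkeeping; proofs kernel-checked; nothing here is a claim about the Yang–Mills mass gap

THE LOCATED ITEM.  `B16Lem384Induction.MergeIndex` (§7 there: the merger in index form — regions in ℤᵈ with admissible trees,
the touch graph of (1.84), tree-length costs, `pFam` under (2.7a), print's `hsub`, the located `hbudget`) has been CONSUMED
(`MergeIndex.controls`, `B16Improved189FullBudgetIndex.mergeT_controls_ofIndex`) but never INHABITED: no file exhibits a term of
it, so the merger theorems' non-vacuity was open (A6 rule №189).  THIS FILE builds one — the smallest honest merger: two NEW
one-cube regions `{0}`, `{1}` on the line (`d = 1`), born at scale `1` with horizon `0`, bracket coefficient `a = 3`, majorant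
constant `Q = 1` (`2Q ≤ a` and the strengthened `3Q ≤ a`), touching (so the touch graph on both indices is connected —
`B16MergeGeometry.gconn_touchGraph_of_faceConnected` through the row `{0,1}`), with admissible one-cube trees, zero (1.80)-sums,
exponent `p₀ = 0` (so `p₀(g) = A₀` for every coupling and (2.7a) reads `1 ≤ 1 + β₀`), `A₀ = 2`, `β₀ = 0`, absorption overshoot
`E = 1`, and the located condition `E + cost(2) = 3 ≤ 2(1+β₀)⁻¹p₀ = 4` — and fires `mergeT_controls_ofIndex` at it with the
terminal terms `t ≡ 1` on the subfamilies (`E_t = 1`, `hbudgetT : E + E_t + cost(2) = 4 ≤ 4`), `t_Z = 1`: (1.80)⁺ for the merged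
component with a strictly positive term.

WHAT THIS FILE PROVES (kernel-checked, zero `sorry`, theorems only — the witness is built INSIDE the proofs, no `def`; axioms
standard): `fam_pair_eq_row` (the union of the two pieces is the row `{0,1}`), `gconn_pair` ((1.84) for the pair),
**`exists_mergeIndex_witness`** (`MergeIndex` inhabited, with its field values displayed), **`mergeT_controls_witness`**
(`mergeT_controls_ofIndex` fires at the witness with `t ≡ 1`, `t_Z = 1`).
HONEST SCOPE.  A toy inhabitant (two cubes, one dimension, static exponent `p₀ = 0`) — an A2 witness, not a model of Bałaban's
regions; the scale-`0` data is EMPTY (no old pieces), so the inductive hypothesis (1.80)⁺ at scale `0` is vacuous there by design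
(the old-piece branch of `mergeT_controls_ofIndex` is exercised by `B16Improved189FullBudgetStep.toy_provenance_step`'s continuation);
count-neutral; N13 NOT discharged; one finite 𝕋⁴ programme at fixed ε, Bałaban AS PRINTED; R4 closes the conditional finite-𝕋⁴ rung
`BalabanLadder.UV` only — nothing continuum ∕ OS ∕ mass gap ∕ Clay.  Seat `pub-ymgap-dag-n13-w2` (g0), N13 [B16], W-SEAT-START-LIST
§1 n13 item 2, `--supports stmt-QuantumFields-20542`.
-/

noncomputable section

namespace Literature.MathematicalPhysics.QuantumFieldTheory.Balaban1983to89.B16Improved189FullBudgetMergeWitness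

open Literature.MathematicalPhysics.QuantumFieldTheory.Balaban1983to89
open Literature.MathematicalPhysics.QuantumFieldTheory.Balaban1983to89.Step
open Literature.MathematicalPhysics.QuantumFieldTheory.Balaban1983to89.Step.Budget
open Literature.MathematicalPhysics.QuantumFieldTheory.Balaban1983to89.B16Improved189FullBudgetIndex
open Literature.MathematicalPhysics.QuantumFieldTheory.Balaban1983to89.B16Lem384Induction
open Literature.MathematicalPhysics.QuantumFieldTheory.Balaban1983to89.B13ScaleTransfer
open Literature.MathematicalPhysics.QuantumFieldTheory.Balaban1983to89.TreeLength
open Literature.MathematicalPhysics.QuantumFieldTheory.Balaban1983to89.B16MergeGeometry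
open Literature.MathematicalPhysics.QuantumFieldTheory.Balaban1983to89.B16MergeGeometry.OneDim

/-- The union of the two pieces is the row `{0, 1}`. [cite: Balaban1989LargeFieldII, p.386 («Z ⊂ X ∪ Y»)] -/
theorem fam_pair_eq_row : fam (fun i : Fin 2 => row ((i : ℕ) : ℤ) 0) Finset.univ = row 0 1 := by
  have hu : (Finset.univ : Finset (Fin 2)) = {0, 1} := by decide
  rw [hu, fam, Finset.biUnion_insert, Finset.singleton_biUnion]
  have h := row_union_row 0 0 0
  simp only [Fin.val_zero, Fin.val_one, Nat.cast_zero, Nat.cast_one, zero_add, add_zero] at h ⊢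
  exact h

/-- **(1.84) FOR THE PAIR**: the touch graph of the two pieces is connected on both indices — the row `{0,1}` is face-connected,
lies in the union and meets both pieces (`gconn_touchGraph_of_faceConnected`). [cite: Balaban1989LargeFieldII, (1.84) p.386 («By (1.84) the graph G is connected»)] -/
theorem gconn_pair : GConn (touchGraph (fun i : Fin 2 => row ((i : ℕ) : ℤ) 0)) Finset.univ := by
  refine gconn_touchGraph_of_faceConnected _ (Z := row 0 1) (faceConnected_row 0 1) (by rw [fam_pair_eq_row]) ?_
    Finset.univ_nonempty
  intro i _
  refine ⟨pt ((i : ℕ) : ℤ), ?_, ?_⟩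
  · have := pt_mem_row (a := 0) (n := 1) (k := (i : ℕ)) (by omega)
    simpa using this
  · have := pt_mem_row (a := ((i : ℕ) : ℤ)) (n := 0) (k := 0) le_rfl
    simpa using this

/-- **`B16Lem384Induction.MergeIndex` INHABITED** (p. 386 «Z is obtained from some number of components of Z_j, and some number of
new large field regions, joined together into the one component of Z_{j+1}» — here: no old components, two new one-cube regions on
the line, touching): over EMPTY scale-`0` data, constants `O(1) = M = 1`, `d_b = 1`, `R ≡ 1`, the family `S = {0, 1}` of NEW pieces
born at scale `1` (coefficient `a = 3`, size `0`, horizon `0`, `Q = 1`), regions `{0}`, `{1}`, (1.80)-sums `rhs ≡ 0`, exponent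
`p₀ = 0` with `A₀ = 2`, `β₀ = 0` along any coupling sequence on `[0, 1]`, overshoot `E = 1`, located condition `1 + cost(2) ≤ 4`,
merged horizon `K = 0`: a `MergeIndex` EXISTS, with these field values. [cite: Balaban1989LargeFieldII, (1.84)–(1.88) pp.386–387] -/
theorem exists_mergeIndex_witness :
    let b : Budget.Consts := ⟨1, 1, 1, fun _ => 1⟩
    let D : ScaleData 0 := ⟨Empty, Empty.elim, fun z => z.elim, Empty.elim, Empty.elim, Empty.elim⟩
    ∃ M : MergeIndex b D (Fin 2) 1, M.S = Finset.univ ∧ (M.P = fun i : Fin 2 => row ((i : ℕ) : ℤ) 0) ∧ M.K = 0 ∧ M.E = 1 ∧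
      M.A₀ = 2 ∧ M.β₀ = 0 ∧ M.p₀ = 0 ∧ (∀ i, ∃ x : Birth b 1, M.prov i = Piece.new x ∧ x.Q = 1 ∧ x.a = 3 ∧ x.d' = 0) := by
  intro b D
  have hcost : ∀ n (s : ℝ), b.cost n s = s := fun n s => by simp [b, Budget.Consts.cost]
  -- the new piece: born at scale 1, a = 3, d' = 0, horizon 0, Q = 1
  let x : Birth b 1 := ⟨3, 0, le_rfl, fun _ => 0, 0, 1, by simp, by rw [hcost]; norm_num, by norm_num⟩
  have hrhs180 : ∀ i : Fin 2, (Piece.new x : Piece b D).rhs180 b = 0 := fun i => by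
    simp [Piece.rhs180, Piece.K, x]
  refine ⟨{ S := Finset.univ
            prov := fun _ => Piece.new x
            P := fun i : Fin 2 => row ((i : ℕ) : ℤ) 0
            hadm := fun i => exists_admissible_row _ 0
            hconn := gconn_pair
            hsize1 := fun i _ => by
              show treeLen (row ((i : ℕ) : ℤ) 0) = x.d'
              rw [row_zero, treeLen_singleton]
            rhs := fun _ => 0
            hrhs1 := fun i _ => (hrhs180 i).symm
            A₀ := 2
            β₀ := 0
            p₀ := 0
            Kf := 1
            g := fun _ => 1 / 2
            hA := by norm_num
            hβ₀ := le_rfl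
            h27 := fun m n _ _ => by simp
            hjK := le_rfl
            hnn := by simp [p0Profile]
            E := 1
            hsub := fun T y _ _ _ _ _ => by norm_num
            hC := zero_le_one
            hM := zero_le_one
            hR := zero_le_one
            hbudget := by rw [hcost]; simp [p0Profile]; norm_num
            K := 0
            size := fun _ => 0
            hrhsZ := by simp }, rfl, rfl, rfl, rfl, rfl, rfl, rfl, fun i => ⟨x, rfl, rfl, rfl, rfl⟩⟩

/-- **`mergeT_controls_ofIndex` FIRES AT THE WITNESS WITH A NON-ZERO TERMINAL TERM**: at any merger `M` with the witness's field
values (empty scale-`0` data — the inductive hypothesis (1.80)⁺ at scale `0` is vacuous by design —, all pieces NEW with `Q = 1`,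
`a = 3`, `d′ = 0`, `E = 1`, `A₀ = 2`, `β₀ = 0`, `p₀ = 0`, constants `O(1) = M = 1`, `d_b = 1`, `R ≡ 1`), the terminal terms
`t ≡ 1` on the subfamilies (`0 ≤ t`, `t ≤ E_t = 1`, `t{x} ≤ Q(d′+1) = 1`, `3Q ≤ a`) and the located `hbudgetT : E + E_t + cost(2) =
4 ≤ 2(1+β₀)⁻¹p₀ = 4` give (1.80)⁺ for the merged component with the strictly positive term `t_Z = 1`:
`Controls b 1 M.K (κ′ − 1) M.size`. [cite: Balaban1989LargeFieldII, (1.85)–(1.88) pp.386–387] -/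
theorem mergeT_controls_witness :
    let b : Budget.Consts := ⟨1, 1, 1, fun _ => 1⟩
    let D : ScaleData 0 := ⟨Empty, Empty.elim, fun z => z.elim, Empty.elim, Empty.elim, Empty.elim⟩
    ∀ M : MergeIndex b D (Fin 2) 1, M.E = 1 → M.A₀ = 2 → M.β₀ = 0 → M.p₀ = 0 →
      (∀ i, ∃ x : Birth b 1, M.prov i = Piece.new x ∧ x.Q = 1 ∧ x.a = 3 ∧ x.d' = 0) →
      Controls b 1 M.K (M.toMergeCase.κ' - 1) M.size := by
  intro b D M hE hA hβ hp hnew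
  have hcost : ∀ n (s : ℝ), b.cost n s = s := fun n s => by simp [b, Budget.Consts.cost]
  refine mergeT_controls_ofIndex b M Empty.elim (fun z => z.elim) (fun _ => 1) (fun _ _ => zero_le_one) 1
    (fun _ _ _ => le_rfl) (fun i _ y hy => ?_) (fun i _ y hy => ?_) ?_ 1 le_rfl
  · exact nomatch y.Z₀
  · obtain ⟨x, hx, hQ, ha, hd⟩ := hnew i
    rw [hx] at hy
    cases hy
    rw [hQ, ha, hd]
    norm_num
  · rw [hE, hA, hβ, hp, hcost]
    simp [p0Profile]
    norm_num

/-- The two theorems together: the merger theorem with the term is NOT vacuous — there IS an `M` at which it fires with `t_Z = 1`. [cite: Balaban1989LargeFieldII, (1.85)–(1.88) pp.386–387] -/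
theorem exists_mergeT_controls_witness :
    let b : Budget.Consts := ⟨1, 1, 1, fun _ => 1⟩
    let D : ScaleData 0 := ⟨Empty, Empty.elim, fun z => z.elim, Empty.elim, Empty.elim, Empty.elim⟩
    ∃ M : MergeIndex b D (Fin 2) 1, M.K = 0 ∧ Controls b 1 M.K (M.toMergeCase.κ' - 1) M.size := by
  intro b D
  obtain ⟨M, -, -, hK, hE, hA, hβ, hp, hnew⟩ := exists_mergeIndex_witness
  exact ⟨M, hK, mergeT_controls_witness M hE hA hβ hp hnew⟩

end Literature.MathematicalPhysics.QuantumFieldTheory.Balaban1983to89.B16Improved189FullBudgetMergeWitness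

end
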